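import Mathlib
import Summits.MatrixMultiplication.MatrixMultiplication.Theorems.SnSubsetDichotomyPolynomialSlackTrichotomyCover
import Summits.MatrixMultiplication.MatrixMultiplication.Theorems.SnSubsetDichotomyPolynomialSlackAtomsTrichotomyArith
import Summits.MatrixMultiplication.MatrixMultiplication.Theorems.SnSubsetDichotomyPolynomialSlackAtomsTrichotomyHalves

/-!
# The atoms trichotomy theorem (3/4 step): a violator with polynomial co-densities has a win

Crux `Summit.MatrixMultiplication.MatrixMultiplication.Theses.SnSubsetDichotomy.PolynomialSlack`
(item `stmt-MatrixMultiplication-8306`), level-one programme, line transport-split-hull (lead c10).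
For a TPP triple whose sparsest quotient profile `dC` is split at a threshold `θC ≥ 16/n` (heavy part
`pC`, heavy mass `≤ Λ`), an almost fully kept level-one mass (`1 - δ ≤ kept`, from `kept_split_C`) and
the co-density cap `log K_A + log K_B + log K_C ≤ q log n + 5`, `q ≤ 3/2`, force a WIN:
`N ≤ W` with `W = polylog(n) · n^{1.49} · B`, `B` any bound on the TPP volumes of `S_{n-1}`.
Proof (all ingredients landed): `trichotomy_cover` (hub rows `R`, hub columns `Q`, scattered cells
negligible via the `ε`-matching), `rows_kept_le` for the original triple (rows `R`, mask `Q`) and for the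
REVERSED triple `(U,T,S)` (rows `Q`, mask `∅`; `tpp_reverse`, `reversed_profiles`), `costs_certified`
(the four entropy costs against `log K_A + log K_B + log K_C` plus a junk term proportional to the included
mass), the rate-box lower bound `cost ≥ 0.245 · included mass` (`incl_rate_bounds_masked`), and the
scalar endgame: `0.981 ≤ (5/8) cost`, `cost (1 - L₁/(0.245 log n)) log n ≤ q log n + 11` is impossible
for `q ≤ 3/2`, `L₁ ≤ log n/500`, `log n ≥ 2000`.  All parameters are explicit functions of `n` and `Λ`
(binders with defining equations), discharged for large `n` by `eventually_trichotomy_ranges`.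

Organisation: the pure real arithmetic (parameter facts `atomsTrichotomy_params`, cover parameters
`atomsTrichotomy_tau`, slop budget `atomsTrichotomy_slop_le`, endgame `atomsTrichotomy_endgame`) is in
`…AtomsTrichotomyArith`; the two hub halves of the cover with the rate box and the certified costs
(`atomsTrichotomy_halves`, exporting only `COST` and `MASS`) are in `…AtomsTrichotomyHalves`; this file
proves by contradiction: under `W < N` every no-win hypothesis of the per-position machinery holds, the
co-densities `K_A, K_B, K_C ≥ 1` (packing) have logarithms in `[0, LK]`, `trichotomy_cover` gives the hub
rows `R` and hub columns `Q` (`|R| τ, |Q| τ ≤ Λ`, so `2(|R|+|Q|)² ≤ n` and `L₁ ≤ log n/500` by the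
ranges), and the endgame closes.
-/

namespace Summit.MatrixMultiplication.MatrixMultiplication.Theorems.PolynomialSlack

open scoped BigOperators
open Literature.Combinatorics.Additive (TripleProductProperty)

set_option linter.dupNamespace false

/-- **The atoms trichotomy theorem.** See the module docstring; the parameters
`ε₂, εm, LK, Φ₀, τ, mR, ε₁, h₁, M, A₀, A₁, P, W` are bound to their defining expressions by the
hypotheses `hε₂ … hWdef`, and `hr1 … hr7` are the range conditions (true for large `n` when
`Λ = 1200 (1 + log n)²`). [folklore] -/
theorem volume_le_of_atoms_trichotomy {n : ℕ} (hn : 40 ≤ n) (B : ℕ)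
    (hB : ∀ S' T' U' : Finset (Equiv.Perm (Fin (n - 1))), TripleProductProperty S' T' U' →
      S'.card * T'.card * U'.card ≤ B)
    {S T U : Finset (Equiv.Perm (Fin n))} (hTPP : TripleProductProperty S T U)
    (hS0 : S.Nonempty) (hT0 : T.Nonempty) (hU0 : U.Nonempty)
    (dA dB dC pC : Fin n → Fin n → ℝ)
    (hdA : ∀ i j, dA i j =
      (((S ×ˢ T).filter fun st => st.2 j = st.1 i).card : ℝ) / (S.card * T.card : ℕ))
    (hdB : ∀ j k, dB j k =
      (((T ×ˢ U).filter fun tu => tu.2 k = tu.1 j).card : ℝ) / (T.card * U.card : ℕ))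
    (hdC : ∀ k i, dC k i =
      (((U ×ˢ S).filter fun us => us.2 i = us.1 k).card : ℝ) / (U.card * S.card : ℕ))
    (θC Λ δ q : ℝ) (hθC : 16 / (n : ℝ) ≤ θC)
    (hpC : ∀ k i, pC k i = if θC ≤ dC k i then dC k i - 1 / n else 0)
    (hΛ : 1 ≤ Λ) (hδ : δ ≤ 1 / 1000) (hq : q ≤ 3 / 2)
    (hmassC : ∑ k : Fin n, ∑ i : Fin n, (if θC ≤ dC k i then dC k i else 0) ≤ Λ)
    (hkept : 1 - δ ≤ -((n : ℝ) - 1) * ∑ i : Fin n, ∑ j : Fin n, ∑ k : Fin n,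
      (dA i j - 1 / n) * (dB j k - 1 / n) * pC k i)
    (hQ : Real.log ((n.factorial : ℝ) / (S.card * T.card : ℕ)) +
        Real.log ((n.factorial : ℝ) / (T.card * U.card : ℕ)) +
        Real.log ((n.factorial : ℝ) / (U.card * S.card : ℕ)) ≤ q * Real.log n + 5)
    (ε₂ εm LK Φ₀ τ mR ε₁ h₁ M A₀ A₁ P W : ℝ)
    (hε₂ : ε₂ = 1 / (1000 * Λ))
    (hεm : εm = ε₂ ^ 2 / (12 * (1 + Real.log n) * (2 + Real.log (1 / ε₂))))
    (hLK : LK = 3 / 2 * Real.log n + 5)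
    (hΦ₀ : Φ₀ = 576 * (1 + Real.log n) * (2 * (Real.log 8 + LK + Real.log (1 / εm))) / εm ^ 3)
    (hτ : τ = 1 / (400 * Φ₀))
    (hmR : mR = ((⌊Real.logb 2 ((n : ℝ) ^ 2)⌋₊ + 1 : ℕ) : ℝ))
    (hε₁ : ε₁ = τ / (10 ^ 5 * Λ * (1 + Real.log n) * mR))
    (hh₁ : h₁ = τ / (10 ^ 4 * Λ * mR ^ 2))
    (hM : M = 10 ^ 4 * Λ * mR ^ 2 / τ)
    (hA₀ : A₀ = 5000 * n * (1 + Real.log n) * (LK + Real.log (4 / ε₂)) / ε₂ ^ 2)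
    (hA₁ : A₁ = (n : ℝ) ^ (1245 / 1000 : ℝ))
    (hP : P = A₀ ^ 2 * (n : ℝ) ^ (-(151 / 100 : ℝ)) / ε₁ ^ 2)
    (hWdef : W = 10 ^ 7 * (1 + Real.log n) ^ 2 * (LK + Real.log (4 / ε₂)) ^ 2 * n * B /
          (ε₂ ^ 4 * h₁ ^ 2) +
        20 * (1 + M) * A₀ ^ 2 * B / (h₁ ^ 2 * n) + n * P * B + 20 * (1 + M) * A₁ ^ 2 * B / (h₁ ^ 2 * n))
    (hr1 : Real.log A₀ ≤ 101 / 100 * Real.log n) (hr2 : A₀ ≤ A₁)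
    (hr3 : 32 ≤ ε₁ * (n : ℝ) ^ (245 / 1000 : ℝ))
    (hr4 : 2 * (2 * Λ / τ + 2) ^ 2 ≤ (n : ℝ))
    (hr5 : Real.log ((4 * Λ / τ + 2) / ε₁) ≤ Real.log n / 500)
    (hr6 : 2000 ≤ Real.log n) (hr7 : 2000 * Λ ≤ (n : ℝ)) :
    ((S.card * T.card * U.card : ℕ) : ℝ) ≤ W := by
  /- (0) basic facts: the three co-densities `K_A, K_B, K_C ≥ 1` (packing), their logarithms lie
  in `[0, LK]`; the parameters `ε₂, τ` and the matching bound (`atomsTrichotomy_tau`) -/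
  have hn2 : 2 ≤ n := by omega
  have hnR : (40 : ℝ) ≤ n := by exact_mod_cast hn
  have hlog1 : 0 ≤ Real.log n := Real.log_nonneg (by linarith only [hnR])
  have hG1 : 1 ≤ 1 + Real.log n := by linarith only [hlog1]
  have hST0 : (0 : ℝ) < (S.card * T.card : ℕ) := by
    exact_mod_cast Nat.mul_pos hS0.card_pos hT0.card_pos
  have hTU0 : (0 : ℝ) < (T.card * U.card : ℕ) := by
    exact_mod_cast Nat.mul_pos hT0.card_pos hU0.card_pos
  have hUS0 : (0 : ℝ) < (U.card * S.card : ℕ) := by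
    exact_mod_cast Nat.mul_pos hU0.card_pos hS0.card_pos
  have hKA1 : 1 ≤ (n.factorial : ℝ) / (S.card * T.card : ℕ) := by
    rw [le_div_iff₀ hST0, one_mul]
    exact_mod_cast card_mul_card_le_factorial_of_injOn (injOn_quot_first hTPP hU0)
  have hKB1 : 1 ≤ (n.factorial : ℝ) / (T.card * U.card : ℕ) := by
    rw [le_div_iff₀ hTU0, one_mul]
    exact_mod_cast card_mul_card_le_factorial_of_injOn (injOn_quot_second hTPP hS0)
  have hKC1 : 1 ≤ (n.factorial : ℝ) / (U.card * S.card : ℕ) := by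
    rw [le_div_iff₀ hUS0, one_mul, Nat.mul_comm]
    exact_mod_cast card_mul_card_le_factorial_of_injOn (injOn_quot_outer hTPP hT0)
  have hlA := Real.log_nonneg hKA1
  have hlB := Real.log_nonneg hKB1
  have hlC := Real.log_nonneg hKC1
  have hqL : q * Real.log n ≤ 3 / 2 * Real.log n := mul_le_mul_of_nonneg_right hq hlog1
  have hLKA : Real.log ((n.factorial : ℝ) / (S.card * T.card : ℕ)) ≤ LK := by
    rw [hLK]; linarith only [hlA, hlB, hlC, hQ, hqL]
  have hLKB : Real.log ((n.factorial : ℝ) / (T.card * U.card : ℕ)) ≤ LK := by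
    rw [hLK]; linarith only [hlA, hlB, hlC, hQ, hqL]
  have hKB1' : 1 ≤ (n.factorial : ℝ) / (U.card * T.card : ℕ) := by rwa [Nat.mul_comm]
  have hLKB' : Real.log ((n.factorial : ℝ) / (U.card * T.card : ℕ)) ≤ LK := by rwa [Nat.mul_comm]
  have hmR1 : 1 ≤ mR := by rw [hmR]; exact_mod_cast Nat.le_add_left 1 _
  obtain ⟨hε₂0, hε₂1, hε₂Λ, hτ0, hτ1, hτΦ⟩ := atomsTrichotomy_tau hn2 Λ LK ε₂ εm Φ₀ τ _ _ hΛ hε₂ hεm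
    hLK hΦ₀ hτ hKA1 hLKA hKB1 hLKB
  /- (1) no win: `W < N`, and the parameter facts for `K_A` and `K_B` -/
  by_contra hcon
  have hN : W < ((S.card * T.card * U.card : ℕ) : ℝ) := lt_of_not_ge hcon
  obtain ⟨hε₁0, hε₁1, -, -, hh₁0, hP0, hMm, hA₀A, hA₀n, hA₁l, hPlow, hWA⟩ :=
    atomsTrichotomy_params hn2 B Λ LK τ mR ε₁ ε₂ h₁ M A₀ A₁ P W _ hΛ hτ0 hτ1 hmR1 hKA1 hLKA hε₂ hLK
      hε₁ hh₁ hM hA₀ hA₁ hP hWdef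
  obtain ⟨-, -, -, -, -, -, -, hA₀B, -, -, -, hWB⟩ :=
    atomsTrichotomy_params hn2 B Λ LK τ mR ε₁ ε₂ h₁ M A₀ A₁ P W _ hΛ hτ0 hτ1 hmR1 hKB1' hLKB' hε₂
      hLK hε₁ hh₁ hM hA₀ hA₁ hP hWdef
  /- (2) the cover: hub rows `R`, hub columns `Q` (few: `|R| τ, |Q| τ ≤ Λ`) -/
  obtain ⟨R, Q, hRτ, hQτ, hcover⟩ := trichotomy_cover hn2 hTPP hS0 hT0 hU0 dA dB dC pC hdA hdB hdC
    θC hθC hpC Λ ε₂ τ hε₂0 hε₂1 hτ0 hmassC hτΦ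
  have hR0 : (0 : ℝ) ≤ R.card := Nat.cast_nonneg _
  have hQ0 : (0 : ℝ) ≤ Q.card := Nat.cast_nonneg _
  have hRle : (R.card : ℝ) ≤ Λ / τ := by rw [le_div_iff₀ hτ0]; exact hRτ
  have hQle : (Q.card : ℝ) ≤ Λ / τ := by rw [le_div_iff₀ hτ0]; exact hQτ
  have h2Λ : 2 * Λ / τ = Λ / τ + Λ / τ := by ring
  have h4Λ : 4 * Λ / τ = 2 * Λ / τ + 2 * Λ / τ := by ring
  have hRQ : 2 * ((R.card : ℝ) + Q.card) ^ 2 ≤ n := by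
    have h1 : (R.card : ℝ) + Q.card ≤ 2 * Λ / τ + 2 := by linarith only [hRle, hQle, h2Λ]
    have h2 := pow_le_pow_left₀ (add_nonneg hR0 hQ0) h1 2
    linarith only [h2, hr4]
  /- (3) the two halves, the slops and the included-mass logarithm -/
  obtain ⟨COST, MASS, -, hrate, hcert, hhalves⟩ := atomsTrichotomy_halves hn2 B hB hTPP hS0 hT0 hU0
    dA dB dC pC hdA hdB hdC θC Λ hθC hpC hmassC ε₁ ε₂ h₁ M A₀ P W A₁ mR hmR hε₁0 hε₂0 hε₂1 hr3 hh₁0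
    hP0 hMm hA₀A hA₀B hA₀n hr1 hA₁l hr2 hPlow hWA hWB hN R Q hRQ
  have hsR := atomsTrichotomy_slop_le hΛ hG1 hmR1 hτ0 hτ1 hε₂ hε₁ hh₁ hM hr7 hR0 hRτ
  have hsQ := atomsTrichotomy_slop_le hΛ hG1 hmR1 hτ0 hτ1 hε₂ hε₁ hh₁ hM hr7 hQ0 hQτ
  have hL₁arg : 1 ≤ (2 * (R.card : ℝ) + 2 * (Q.card : ℝ) + 2) / ε₁ := by
    rw [le_div_iff₀ hε₁0]; linarith only [hR0, hQ0, hε₁1]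
  have hL₁ : Real.log ((2 * (R.card : ℝ) + 2 * (Q.card : ℝ) + 2) / ε₁) ≤ Real.log n / 500 := by
    refine le_trans (Real.log_le_log (by linarith only [hL₁arg]) ?_) hr5
    exact div_le_div_of_nonneg_right (by linarith only [hRle, hQle, h2Λ, h4Λ]) hε₁0.le
  /- (4) the endgame -/
  exact atomsTrichotomy_endgame hr6 hq hδ hkept hcover hε₂Λ hhalves hsR hsQ hrate hcert hQ
    (Real.log_nonneg hL₁arg) hL₁

end Summit.MatrixMultiplication.MatrixMultiplication.Theorems.PolynomialSlack
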